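import Literature.NumberTheory.DiophantineGeometry.GeneralizedFermatTwoPowerCoefficientFreySwanEightProofs
import Literature.NumberTheory.DiophantineGeometry.GeneralizedFermatTwoPowerCoefficientFreySaitoProofs
import Literature.NumberTheory.DiophantineGeometry.GeneralizedFermatTwoPowerCoefficientFreyIsogenyProofs
import Literature.NumberTheory.DiophantineGeometry.FreyCurveConductorTwoBadSignProofs
import Literature.NumberTheory.DiophantineGeometry.FreyCurveConductorTwoTwistDichotomyProofs
import Literature.NumberTheory.DiophantineGeometry.DenesEquationFreyCurveTwoProofs
import Literature.NumberTheory.DiophantineGeometry.DenesEquationLargeExponentsProofs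
import Literature.NumberTheory.DiophantineGeometry.LocalReductionProofs
import Literature.NumberTheory.EllipticCurves.QuadraticTwistSwanConductorMaxProofs
import Literature.NumberTheory.EllipticCurves.QuadraticTwistTateFormTwoProofs
import Literature.NumberTheory.EllipticCurves.CanonicalPAdicHeightRestrictionProofs
import Literature.NumberTheory.EllipticCurves.CuspFormLFunctionLevelConductorOfCarayolProofs
import Literature.NumberTheory.Automorphic.CDTTheorem722
import Literature.NumberTheory.Automorphic.BCDTModularity
import Summits.ABC.ABC.Theorems.DefiniteXiFreyModularityCMCorner
import HarnessLib

/-!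
# stub-ideation k3 (gen 3, FAMILY 3 — probe the extremes) for `stub_threeImpTwo` (S9) of crux
`FreyModularity` (stmt-ABC-11340), line `Sketch`

Companion of `STUB-IDEAS-stub_threeImpTwo-3.md` (gen 3 supersedes gen 2's file of the same slot).

**The plan.** S9 (BCDT (3) ⇒ (2), verbatim `∀ W`) is consumed by `FreyModularity_of` only at
I1 = (`freyCurve a b`, `ℓ = 3`), I2 = (the switched curve `W′`, `ℓ = 3`), I3 = (`freyCurve a b`,
`ℓ = 5`).  Every closer of S9 in the tree needs, besides Carayol 1986 (Thm. (A)) and a source of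
"some-level" newforms, SAITO's `p = 2` leaf
`W.swanConductorAt_rationalTate_eq_wildConductorExponent_of_ringChar_eq_two ℓ` for the curve at hand
(`IsNewformOf.level_eq_conductorNorm_of_carayol1986_of_saito`).  FAMILY 3 reads the Frey family at its
2-adic EXTREMES: the place `2` of `E_(A,B) : y² = x(x − A)(x + B)` runs through exactly four rows
(`A` odd, `2 ∣ B`; `AB(A+B) ≠ 0`):

| row                         | Kodaira        | `f₂` | `δ₂` | `Sw_𝔓(E[3])` (tree)                                  |
|-----------------------------|----------------|------|------|------------------------------------------------------|
| `16 ∣ B`                    | `I_n` / `I*_n` | ≤ 4  | —    | not needed: `ord₂ j = 8 − 2 ord₂ B ≤ 0` (H5)          |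
| `4 ∣ B`, `16 ∤ B`, `A ≡ −1` | `I₁*`, `III*`  | 3    | 1    | `= 1` (`exists_swanConductorAt_…_of_sixteen_not_dvd`) |
| `4 ∣ B`, `16 ∤ B`, `A ≡ +1` | `I₀*`, `I₂*`   | 4    | 2    | `= 2` (H1, twist-max formula)                         |
| `2 ∥ B`, `2A + B ≠ 0`       | `III`          | 5    | 3    | `= 3` (`Summit…_of_two_mul` + H4a translate)          |

and the engine `…_of_ringChar_eq_two_of_valuation_j_lt_one` turns the table into Saito's leaf for
every Frey curve OFF THE CM CORNER `|ab(a+b)| = 2` (H6, H7).  The corner (`E ≅ 32a2`, `j = 1728`,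
`c₆ = 0`: no `2`-adic class theorem of the tree applies — gen-2's H7 overlooked this) is ALREADY
MODULAR unconditionally (`Summit.ABC.ABC.Theorems.isModular_freyCurve_of_natAbs_eq_two`, landed), so
the per-instance S9 for I1/I3 (`threeImpTwo_freyCurve`) splits on the corner and needs Saito nowhere:
its closing set is {`Carayol1986_artinConductorExponent`, a some-level newform source `hSome`} — one
named fact FEWER than every `∀ W` closer (`stub_threeImpTwo_of_two_facts`: Eichler–Shimura + Carayol's
level statement for all curves, the latter containing Saito for all curves).

ALL helper lemmas below are PROVED (no `sorry`): this file is a certificate that the slot-3 plan is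
executable today, not a sketch.  The ONE tree input not imported is the landed good-sign `2 ∥ B` Swan
value `Summit.ABC.ABC.Theorems.swanConductorAt_torsion_three_freyCurve_of_two_mul`
(`Summits/ABC/ABC/Theorems/DefiniteXiFreyModularityStubFreySwanOdd.lean`): it is carried as the
hypothesis `(hOdd : FreySwanThreeOfTwoMul)` — LITERALLY that theorem's type — because its class-file
import `ThreeTorsionSwanAtTwoClassD6C4C7M8R7M2R1Proofs` was unbuilt on the farm when this file was
published (rc 75).  Instantiate: `threeImpTwo_freyCurve hCA hSome
Summit.ABC.ABC.Theorems.swanConductorAt_torsion_three_freyCurve_of_two_mul …` after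
`import Summits.ABC.ABC.Theorems.DefiniteXiFreyModularityStubFreySwanOdd`.
-/

noncomputable section

open scoped NumberField
open IsDedekindDomain WeierstrassCurve Rat.HeightOneSpectrum
open Literature.NumberTheory.EllipticCurves Literature.NumberTheory.EllipticCurves.ModularForms
open Literature.NumberTheory.GaloisRepresentations Literature.NumberTheory.DiophantineGeometry
open Literature.NumberTheory.Automorphic

namespace Summit.ABC.ABC.Cruxes.FreyModularity.Sketch.ThreeImpTwoIdeas3g3

attribute [local instance] AddSubgroup.torsionBy.zmodModule

variable {A B : ℤ}

/-! ## The place `v₂` of `𝓞 ℚ` above `2` -/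

/-- `2 ∈ v₂`. [folklore] -/
theorem two_mem_v₂ : (2 : 𝓞 ℚ) ∈ ((primesEquiv (R := 𝓞 ℚ)).symm ⟨2, Nat.prime_two⟩).asIdeal := by
  have := (natCast_mem_asIdeal_iff_eq_primesEquiv_symm
    ((primesEquiv (R := 𝓞 ℚ)).symm ⟨2, Nat.prime_two⟩) Nat.prime_two).mpr rfl
  exact_mod_cast this

/-- `3 ∉ v₂`. [folklore] -/
theorem three_notMem_v₂ :
    ((3 : ℕ) : 𝓞 ℚ) ∉ ((primesEquiv (R := 𝓞 ℚ)).symm ⟨2, Nat.prime_two⟩).asIdeal :=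
  Ribet1997.three_notMem_of_two_mem two_mem_v₂

/-! ## Row "bad sign, `4 ∣ B`, `16 ∤ B`" (Kodaira `I₀*` / `I₂*`, `f₂ = 4`, `δ₂ = 2`) -/

/-- **H1 — `Sw_𝔓(E[3]) = 2` for the bad-sign additive Frey curves, by the twist-max formula, no fake
points.**  `E_(A,B) = (E_(−A,−B))^{(−1)}` (`quadraticTwist_freyCurve_neg_one`, `freyCurve_swap`),
`E_(−A,−B)` is a good-sign curve with `Sw = 1` (`exists_swanConductorAt_torsion_three_freyCurve_of_sixteen_not_dvd`),
and `−1 ≡ 3 (mod 4)` gives `Sw(E^{(−1)}[3]) = max (1, 2) = 2`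
(`Rat.swanConductorAt_torsion_quadraticTwist_eq_max_two_of_emod_four_eq_three`). (gen 2, PROVED) -/
theorem exists_swanConductorAt_torsion_three_freyCurve_badSign (h0 : A * B * (A + B) ≠ 0)
    (hA : A ≡ 1 [ZMOD 4]) (h4 : (4 : ℤ) ∣ B) (h16 : ¬ (16 : ℤ) ∣ B) :
    ∃ 𝔓 ∈ ((primesEquiv (R := 𝓞 ℚ)).symm ⟨2, Nat.prime_two⟩).primesAbove,
      ((freyCurve A B).torsionGaloisRep 3).swanConductorAt (𝓞 ℚ) 𝔓 = 2 := by
  -- the good-sign partner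
  have h0' : (-A) * (-B) * (-A + -B) ≠ 0 := by
    intro h; apply h0; nlinarith [h]
  have hA' : -A ≡ -1 [ZMOD 4] := by unfold Int.ModEq at hA ⊢; omega
  have h4' : (4 : ℤ) ∣ -B := (dvd_neg).mpr h4
  have h16' : ¬ (16 : ℤ) ∣ -B := fun h ↦ h16 ((dvd_neg).mp h)
  obtain ⟨𝔓, h𝔓, hSw⟩ :=
    exists_swanConductorAt_torsion_three_freyCurve_of_sixteen_not_dvd h0' hA' h4' h16'
  haveI : (freyCurve (-A) (-B)).IsElliptic := isElliptic_freyCurve h0'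
  have key := Rat.swanConductorAt_torsion_quadraticTwist_eq_max_two_of_emod_four_eq_three
    (freyCurve (-A) (-B)) 3 (by decide) (d := -1) (by decide) two_mem_v₂ three_notMem_v₂ h𝔓
    (by rw [hSw]; norm_num) (by rw [hSw]; norm_num)
  rw [hSw] at key
  have htw : (freyCurve (-A) (-B)).quadraticTwist (((-1 : ℤ) : ℚ)) = freyCurve A B := by
    rw [Int.cast_neg, Int.cast_one, quadraticTwist_freyCurve_neg_one, freyCurve_swap, neg_neg, neg_neg]
  rw [htw] at key
  refine ⟨𝔓, h𝔓, ?_⟩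
  rw [key]
  norm_num

/-- **H2 — `δ₂ = 2` in the bad sign** (places of `ℤ`): Kodaira `I₀*` (`4 ∥ B`) resp. `I₂*` (`8 ∥ B`),
`f₂ = 4` (`kodairaSymbolAt_freyCurve_two_of_{four,eight}_dvd_of_four_dvd_sub_one`, Diamond–Kramer's
rows twisted by `ℚ(i)`), `ε₂ = 2`. [cite: DiamondKramer1995, Lemma 1 and Lemma 2, p. 300] -/
theorem wildConductorExponent_freyCurve_two_eq_two (v : HeightOneSpectrum ℤ)
    (hv : natGenerator v = 2) (h0 : A * B * (A + B) ≠ 0) (hA : A ≡ 1 [ZMOD 4]) (h4 : (4 : ℤ) ∣ B)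
    (h16 : ¬ (16 : ℤ) ∣ B) : (freyCurve A B).wildConductorExponent v = 2 := by
  have hA' : 4 ∣ A - 1 := Int.ModEq.dvd hA.symm
  obtain ⟨b₀, hb₀⟩ := h4
  unfold WeierstrassCurve.wildConductorExponent
  by_cases h2 : (2 : ℤ) ∣ b₀
  · obtain ⟨b, hb⟩ := h2
    have hbodd : ¬ (2 : ℤ) ∣ b := fun ⟨e, he⟩ ↦ h16 ⟨e, by rw [hb₀, hb, he]; ring⟩
    obtain ⟨hK, -, hf⟩ := kodairaSymbolAt_freyCurve_two_of_eight_dvd_of_four_dvd_sub_one v hv h0 hA'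
      (b := b) (by rw [hb₀, hb]; ring) hbodd
    rw [hK, hf]
    rfl
  · obtain ⟨hK, -, hf⟩ :=
      kodairaSymbolAt_freyCurve_two_of_four_dvd_of_four_dvd_sub_one v hv h0 hA' hb₀ h2
    rw [hK, hf]
    rfl

/-- H2 at the place of `𝓞 ℚ` above `2` (transport `wildConductorExponent_eq_of_primesEquiv_eq`).
[cite: DiamondKramer1995, Lemma 1 and Lemma 2, p. 300] -/
theorem wildConductorExponent_freyCurve_two_eq_two_ringOfIntegers (v : HeightOneSpectrum (𝓞 ℚ))
    (hv : (2 : 𝓞 ℚ) ∈ v.asIdeal) (h0 : A * B * (A + B) ≠ 0) (hA : A ≡ 1 [ZMOD 4])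
    (h4 : (4 : ℤ) ∣ B) (h16 : ¬ (16 : ℤ) ∣ B) : (freyCurve A B).wildConductorExponent v = 2 := by
  haveI := isElliptic_freyCurve h0
  set v₂ : HeightOneSpectrum ℤ := (primesEquiv (R := ℤ)).symm ⟨2, Nat.prime_two⟩ with hv₂
  have hv₂' : natGenerator v₂ = 2 :=
    Literature.NumberTheory.EllipticCurves.Rat.natGenerator_primesEquiv_symm ⟨2, Nat.prime_two⟩
  have hvv : (primesEquiv (R := ℤ) v₂ : Nat.Primes) = primesEquiv (R := 𝓞 ℚ) v := by
    apply Subtype.ext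
    change natGenerator v₂ = natGenerator v
    rw [hv₂', Literature.NumberTheory.GaloisRepresentations.Rat.natGenerator_eq_two hv]
  rw [← wildConductorExponent_eq_of_primesEquiv_eq v₂ v (freyCurve A B) hvv]
  exact wildConductorExponent_freyCurve_two_eq_two v₂ hv₂' h0 hA h4 h16

/-! ## Row "`2 ∥ B`" (Kodaira `III`, `f₂ = 5`, `δ₂ = 3`, either sign) -/

/-- **H3 — `δ₂ = 3` for `2 ∥ B`, `A` odd** (places of `ℤ`): Kodaira `III`, `f₂ = 5`
(`kodairaSymbolAt_freyCurve_two_of_two_dvd`), `ε₂ = 2`. [cite: DiamondKramer1995, Lemma 2]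
[cite: DarmonMerel1997, Prop. 1.1 (1)] -/
theorem wildConductorExponent_freyCurve_two_eq_three_of_two_mul_int (v : HeightOneSpectrum ℤ)
    (hv : natGenerator v = 2) (h0 : A * B * (A + B) ≠ 0) (hA : ¬ (2 : ℤ) ∣ A) {b : ℤ}
    (hB : B = 2 * b) (hb : ¬ (2 : ℤ) ∣ b) : (freyCurve A B).wildConductorExponent v = 3 := by
  unfold WeierstrassCurve.wildConductorExponent
  obtain ⟨hK, -, hf⟩ := kodairaSymbolAt_freyCurve_two_of_two_dvd v hv h0 hA hB hb
  rw [hK, hf]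
  rfl

/-- H3 at the place of `𝓞 ℚ` above `2`. [cite: DiamondKramer1995, Lemma 2] -/
theorem wildConductorExponent_freyCurve_two_eq_three_of_two_mul (v : HeightOneSpectrum (𝓞 ℚ))
    (hv : (2 : 𝓞 ℚ) ∈ v.asIdeal) (h0 : A * B * (A + B) ≠ 0) (hA : ¬ (2 : ℤ) ∣ A) {b : ℤ}
    (hB : B = 2 * b) (hb : ¬ (2 : ℤ) ∣ b) : (freyCurve A B).wildConductorExponent v = 3 := by
  haveI := isElliptic_freyCurve h0
  set v₂ : HeightOneSpectrum ℤ := (primesEquiv (R := ℤ)).symm ⟨2, Nat.prime_two⟩ with hv₂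
  have hv₂' : natGenerator v₂ = 2 :=
    Literature.NumberTheory.EllipticCurves.Rat.natGenerator_primesEquiv_symm ⟨2, Nat.prime_two⟩
  have hvv : (primesEquiv (R := ℤ) v₂ : Nat.Primes) = primesEquiv (R := 𝓞 ℚ) v := by
    apply Subtype.ext
    change natGenerator v₂ = natGenerator v
    rw [hv₂', Literature.NumberTheory.GaloisRepresentations.Rat.natGenerator_eq_two hv]
  rw [← wildConductorExponent_eq_of_primesEquiv_eq v₂ v (freyCurve A B) hvv]
  exact wildConductorExponent_freyCurve_two_eq_three_of_two_mul_int v₂ hv₂' h0 hA hB hb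

/-- **H4a — the second even presentation**: translating the root `−B` to the origin (`x ↦ x − B`,
`(u, r, s, t) = (1, −B, 0, 0)`), `E_(A,B) ≅ E_(A+B,−B)`; for `2 ∥ B` it flips the class of the odd
root mod `4`. [cite: SilvermanAEC2009, III.1 Table 3.1] -/
theorem translate_freyCurve' (A B : ℤ) :
    (⟨1, -(B : ℚ), 0, 0⟩ : VariableChange ℚ) • freyCurve A B = freyCurve (A + B) (-B) := by
  ext
  · simp only [variableChange_a₁, freyCurve_a₁, Units.val_one, inv_one]; ring
  · simp only [variableChange_a₂, freyCurve_a₁, freyCurve_a₂, Units.val_one, inv_one, Int.cast_neg,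
      Int.cast_add]; ring
  · simp only [variableChange_a₃, freyCurve_a₁, freyCurve_a₃, Units.val_one, inv_one]; ring
  · simp only [variableChange_a₄, freyCurve_a₁, freyCurve_a₂, freyCurve_a₃, freyCurve_a₄,
      Units.val_one, inv_one, Int.cast_neg, Int.cast_add]; ring
  · simp only [variableChange_a₆, freyCurve_a₁, freyCurve_a₂, freyCurve_a₃, freyCurve_a₄,
      freyCurve_a₆, Units.val_one, inv_one]; ring

/-- **The good-sign `2 ∥ B` Swan value, as a named hypothesis.**  This is VERBATIM the type of the
landed theorem `Summit.ABC.ABC.Theorems.swanConductorAt_torsion_three_freyCurve_of_two_mul`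
(`Summits/ABC/ABC/Theorems/DefiniteXiFreyModularityStubFreySwanOdd.lean`, from the fake-point class
files `D6C4C7M8R7M2R1` / `D6C4Cge8M8R3`); it is a hypothesis here only because that module was
unbuilt on the Lean farm at publication time. [cite: DiamondKramer1995, Lemma 2] -/
def FreySwanThreeOfTwoMul : Prop :=
  ∀ {A B : ℤ}, A * B * (A + B) ≠ 0 → A ≡ -1 [ZMOD 4] → ∀ {b : ℤ}, B = 2 * b → Odd b →
    2 * A + B ≠ 0 → ∀ {v : HeightOneSpectrum (𝓞 ℚ)}, (2 : 𝓞 ℚ) ∈ v.asIdeal →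
      ∀ {𝔓 : Ideal (absIntegers (𝓞 ℚ) ℚ)}, 𝔓 ∈ v.primesAbove →
        ((freyCurve A B).torsionGaloisRep 3).swanConductorAt (𝓞 ℚ) 𝔓 = 3

/-- **H4 — `Sw_𝔓(E[3]) = 3` for `2 ∥ B` and EITHER sign of `A`** (`A` odd, `2A + B ≠ 0`), at every
`𝔓 ∣ v₂`, from the good-sign value `hOdd` (= the landed
`Summit.ABC.ABC.Theorems.swanConductorAt_torsion_three_freyCurve_of_two_mul`); bad sign `A ≡ 1` goes
through H4a (`A + B ≡ −1 (mod 4)`, `−B = 2(−b)`, `2(A+B) + (−B) = 2A + B`) and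
`swanConductorAt_torsion_eq_of_smul_eq`. [cite: DiamondKramer1995, Lemma 2] -/
theorem swanConductorAt_torsion_three_freyCurve_of_two_mul' (hOdd : FreySwanThreeOfTwoMul)
    (h0 : A * B * (A + B) ≠ 0)
    (hA : ¬ (2 : ℤ) ∣ A) {b : ℤ} (hB : B = 2 * b) (hb : ¬ (2 : ℤ) ∣ b) (h2AB : 2 * A + B ≠ 0)
    {𝔓 : Ideal (absIntegers (𝓞 ℚ) ℚ)}
    (h𝔓 : 𝔓 ∈ ((primesEquiv (R := 𝓞 ℚ)).symm ⟨2, Nat.prime_two⟩).primesAbove) :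
    ((freyCurve A B).torsionGaloisRep 3).swanConductorAt (𝓞 ℚ) 𝔓 = 3 := by
  have hbodd : Odd b := Int.not_even_iff_odd.mp (fun h ↦ hb (even_iff_two_dvd.mp h))
  by_cases hs : A ≡ -1 [ZMOD 4]
  · exact hOdd h0 hs hB hbodd h2AB two_mem_v₂ h𝔓
  · -- bad sign: pass to the presentation `E_(A+B,−B)`
    have hs' : A + B ≡ -1 [ZMOD 4] := by
      obtain ⟨m, hm⟩ := hbodd; unfold Int.ModEq at hs ⊢; omega
    have h0' : (A + B) * (-B) * ((A + B) + (-B)) ≠ 0 := by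
      intro h; apply h0; linear_combination -h
    have hBm : -B = 2 * (-b) := by rw [hB]; ring
    have h2AB' : 2 * (A + B) + (-B) ≠ 0 := by
      intro h; apply h2AB; linear_combination h
    haveI := isElliptic_freyCurve h0
    haveI := isElliptic_freyCurve h0'
    rw [swanConductorAt_torsion_eq_of_smul_eq (translate_freyCurve' A B) 3 three_notMem_v₂ h𝔓]
    exact hOdd h0' hs' hBm hbodd.neg h2AB' two_mem_v₂ h𝔓

/-! ## Row "`16 ∣ B`": `ord₂ j ≤ 0`, the `j`-engine's hypothesis `|j|₂ < 1` is void -/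

/-- `A² + AB + B²` is odd for `A` odd, `B` even. [folklore] -/
theorem not_two_dvd_sq_add_mul_add_sq (hA : ¬ (2 : ℤ) ∣ A) (h2 : (2 : ℤ) ∣ B) :
    ¬ (2 : ℤ) ∣ A ^ 2 + A * B + B ^ 2 := by
  have hBeven : Even B := even_iff_two_dvd.mpr h2
  have hAodd : Odd A := Int.not_even_iff_odd.mp (fun h ↦ hA (even_iff_two_dvd.mp h))
  have hNodd : Odd (A ^ 2 + A * B + B ^ 2) :=
    (hAodd.pow.add_even (hBeven.mul_left A)).add_even (hBeven.pow_of_ne_zero two_ne_zero)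
  exact fun h ↦ Int.not_even_iff_odd.mpr hNodd (even_iff_two_dvd.mpr h)

/-- **`ord₂ j(E_(A,B)) = 8 − 2 ord₂ (AB(A+B))` for `A` odd, `B` even**:
`j = 2⁸ (A² + AB + B²)³ / (AB(A+B))²` (`j_freyCurve`) with `A² + AB + B²` odd.
[cite: Serre1987, §4.1 (4.1.9)] [cite: DiamondKramer1995, Lemma 1] -/
theorem padicValRat_j_freyCurve_of_two_dvd [(freyCurve A B).IsElliptic] (h0 : A * B * (A + B) ≠ 0)
    (hA : ¬ (2 : ℤ) ∣ A) (h2 : (2 : ℤ) ∣ B) :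
    padicValRat 2 (freyCurve A B).j = 8 - 2 * (padicValInt 2 (A * B * (A + B)) : ℤ) := by
  have hN2 := not_two_dvd_sq_add_mul_add_sq hA h2
  have hN0 : A ^ 2 + A * B + B ^ 2 ≠ 0 := fun h ↦ hN2 (by rw [h]; exact dvd_zero 2)
  have hvN : padicValInt 2 (A ^ 2 + A * B + B ^ 2) = 0 :=
    padicValInt.eq_zero_of_not_dvd (by exact_mod_cast hN2)
  have h22 : padicValRat 2 (2 : ℚ) = 1 := by exact_mod_cast padicValRat.self (p := 2) one_lt_two
  have e1 : ((A : ℚ) ^ 2 + A * B + B ^ 2) = ((A ^ 2 + A * B + B ^ 2 : ℤ) : ℚ) := by push_cast; ring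
  have e2 : ((A : ℚ) * B * (A + B)) = ((A * B * (A + B) : ℤ) : ℚ) := by push_cast; ring
  have hNq : ((A ^ 2 + A * B + B ^ 2 : ℤ) : ℚ) ≠ 0 := by exact_mod_cast hN0
  have hDq : ((A * B * (A + B) : ℤ) : ℚ) ≠ 0 := by exact_mod_cast h0
  rw [j_freyCurve h0, e1, e2,
    padicValRat.div (mul_ne_zero (by norm_num) (pow_ne_zero _ hNq)) (pow_ne_zero _ hDq),
    padicValRat.mul (by norm_num) (pow_ne_zero _ hNq), padicValRat.pow, padicValRat.pow,
    padicValRat.pow, padicValRat.of_int, padicValRat.of_int, hvN, h22]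
  push_cast
  ring

/-- **H5 — `1 ≤ |j(E_(A,B))|_{v₂}` (i.e. `ord₂ j ≤ 0`) for `A` odd, `16 ∣ B`**: `ord₂ j = 8 − 2 ord₂ B
≤ 0`; read at the place `v₂` via `valuation_ratCast_eq_one_of_padicValRat_eq_zero` /
`one_lt_valuation_ratCast_of_padicValRat_neg`.  These curves are semistable at `2` (good sign) or the
`ℚ(i)`-twist `I*_{2k−4}` of one (bad sign) — potentially multiplicative / good, never potentially
supersingular. [cite: DiamondKramer1995, Lemma 1] [cite: SilvermanAEC2009, Prop. VII.5.5] -/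
theorem one_le_valuation_j_freyCurve_of_sixteen_dvd [(freyCurve A B).IsElliptic]
    (h0 : A * B * (A + B) ≠ 0) (hA : ¬ (2 : ℤ) ∣ A) (h16 : (16 : ℤ) ∣ B) :
    1 ≤ ((primesEquiv (R := 𝓞 ℚ)).symm ⟨2, Nat.prime_two⟩).valuation ℚ (freyCurve A B).j := by
  have h2B : (2 : ℤ) ∣ B := dvd_trans (by norm_num) h16
  have hkey := padicValRat_j_freyCurve_of_two_dvd h0 hA h2B
  have hdvd : ((2 : ℕ) : ℤ) ^ 4 ∣ A * B * (A + B) := by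
    have e : ((2 : ℕ) : ℤ) ^ 4 = 16 := by norm_num
    rw [e]; exact (h16.mul_left A).mul_right (A + B)
  have h4 : 4 ≤ padicValInt 2 (A * B * (A + B)) := by
    rcases (padicValInt_dvd_iff (p := 2) 4 (A * B * (A + B))).mp hdvd with h | h
    · exact absurd h h0
    · exact h
  have hle : padicValRat 2 (freyCurve A B).j ≤ 0 := by rw [hkey]; omega
  have hj0 : (freyCurve A B).j ≠ 0 := by
    have hN0 : A ^ 2 + A * B + B ^ 2 ≠ 0 := fun h ↦
      not_two_dvd_sq_add_mul_add_sq hA h2B (by rw [h]; exact dvd_zero 2)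
    have hNq : ((A : ℚ) ^ 2 + A * B + B ^ 2) ≠ 0 := by exact_mod_cast hN0
    have hDq : ((A : ℚ) * B * (A + B)) ≠ 0 := by exact_mod_cast h0
    rw [j_freyCurve h0]
    exact div_ne_zero (mul_ne_zero (by norm_num) (pow_ne_zero _ hNq)) (pow_ne_zero _ hDq)
  have h2v : ((2 : ℕ) : 𝓞 ℚ) ∈ ((primesEquiv (R := 𝓞 ℚ)).symm ⟨2, Nat.prime_two⟩).asIdeal := by
    exact_mod_cast two_mem_v₂
  rcases hle.eq_or_lt with h | h
  · have := valuation_ratCast_eq_one_of_padicValRat_eq_zero (K := ℚ) Nat.prime_two h2v hj0 h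
    rw [Rat.cast_id] at this
    exact this.symm.le
  · have := one_lt_valuation_ratCast_of_padicValRat_neg (K := ℚ) Nat.prime_two h2v h
    rw [Rat.cast_id] at this
    exact this.le

/-! ## Assembly: Saito's `p = 2` leaf for every Frey curve off the CM corner -/

/-- **H6 — Saito at `2` for every even presentation** (`A` odd, `2 ∣ B`, `AB(A+B) ≠ 0`,
`2A + B ≠ 0`), every `ℓ`: the engine
`swanConductorAt_rationalTate_eq_wildConductorExponent_of_ringChar_eq_two_of_valuation_j_lt_one` fed
row by row — `16 ∣ B`: H5 makes `|j|₂ < 1` absurd; `4 ∣ B`, `16 ∤ B`: good sign `Sw = 1 = δ₂`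
(tree), bad sign H1 + H2; `2 ∥ B`: H4 + H3.
[cite: SilvermanATAEC1994, Thm. IV.11.1 (PDF p. 365; p. 366 for p = 2)] [cite: Saito1988, Theorem 1]
[cite: DiamondKramer1995, Lemmas 1–2] -/
theorem freySaito_of_even (hOdd : FreySwanThreeOfTwoMul) (ℓ : ℕ) [Fact ℓ.Prime]
    (h0 : A * B * (A + B) ≠ 0) (hA : ¬ (2 : ℤ) ∣ A) (h2 : (2 : ℤ) ∣ B) (h2AB : 2 * A + B ≠ 0) :
    (freyCurve A B).swanConductorAt_rationalTate_eq_wildConductorExponent_of_ringChar_eq_two ℓ := by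
  -- NB (elaboration): `ℓ [Fact ℓ.Prime]` come FIRST — a term of the (instance-headed) Saito def
  -- produced right after an instance binder gets over-applied by the app elaborator.
  refine (freyCurve A B).swanConductorAt_rationalTate_eq_wildConductorExponent_of_ringChar_eq_two_of_valuation_j_lt_one
    ℓ ?_
  intro _ _hadd hj
  by_cases h16 : (16 : ℤ) ∣ B
  · exact absurd hj (not_lt.mpr (one_le_valuation_j_freyCurve_of_sixteen_dvd h0 hA h16))
  by_cases h4 : (4 : ℤ) ∣ B
  · by_cases hs : A ≡ -1 [ZMOD 4]
    · obtain ⟨𝔓, h𝔓, hSw⟩ :=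
        exists_swanConductorAt_torsion_three_freyCurve_of_sixteen_not_dvd h0 hs h4 h16
      refine ⟨𝔓, h𝔓, ?_⟩
      rw [hSw, wildConductorExponent_freyCurve_two_eq_one_ringOfIntegers _ two_mem_v₂ h0 hs h4 h16,
        Nat.cast_one]
    · have hs' : A ≡ 1 [ZMOD 4] := by unfold Int.ModEq at hs ⊢; omega
      obtain ⟨𝔓, h𝔓, hSw⟩ := exists_swanConductorAt_torsion_three_freyCurve_badSign h0 hs' h4 h16
      refine ⟨𝔓, h𝔓, ?_⟩
      rw [hSw, wildConductorExponent_freyCurve_two_eq_two_ringOfIntegers _ two_mem_v₂ h0 hs' h4 h16]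
      norm_num
  · obtain ⟨b, hb⟩ := h2
    have hbodd : ¬ (2 : ℤ) ∣ b := fun ⟨c, hc⟩ ↦ h4 ⟨c, by rw [hb, hc]; ring⟩
    obtain ⟨𝔓, h𝔓⟩ := HeightOneSpectrum.primesAbove_nonempty
      ((primesEquiv (R := 𝓞 ℚ)).symm ⟨2, Nat.prime_two⟩)
    refine ⟨𝔓, h𝔓, ?_⟩
    rw [swanConductorAt_torsion_three_freyCurve_of_two_mul' hOdd h0 hA hb hbodd h2AB h𝔓,
      wildConductorExponent_freyCurve_two_eq_three_of_two_mul _ two_mem_v₂ h0 hA hb hbodd]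
    norm_num

/-- **H7a — the named Saito leaf is an isomorphism invariant** (`C • W = W'`):
`swanConductorAt_rationalTate_variableChange` + `wildConductorExponent_smul'` +
`hasAdditiveReductionAt_smul_iff_holds`, as inlined in `OggFormulaJZeroTwoProofs`.
[cite: SilvermanATAEC1994, §IV.10 (the conductor is an invariant of E)] -/
theorem saitoTwo_of_smul_eq {W W' : WeierstrassCurve ℚ} [W.IsElliptic] {C : VariableChange ℚ}
    (e : C • W = W') (ℓ : ℕ) [Fact ℓ.Prime]
    (h : W'.swanConductorAt_rationalTate_eq_wildConductorExponent_of_ringChar_eq_two ℓ) :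
    W.swanConductorAt_rationalTate_eq_wildConductorExponent_of_ringChar_eq_two ℓ := by
  subst e
  intro _ hc v hℓ hadd h2 𝔓 h𝔓
  haveI := perfectField_residueField_adicCompletionIntegers (K := ℚ) v
  have hadd' : (C • W).HasAdditiveReductionAt v :=
    (hasAdditiveReductionAt_smul_iff_holds v W C).mpr hadd
  have hc' := (C • W).continuous_rationalGaloisRepTate_holds ℓ
  rw [← wildConductorExponent_smul' v W C,
    ← W.swanConductorAt_rationalTate_variableChange C ℓ hc hc' hℓ h𝔓]
  exact h hc' v hℓ hadd' h2 h𝔓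

/-- **Off the CM corner, `2a + b ≠ 0` for coprime `a, b`** (`2a + b = 0` forces `a = ±1`,
`(a, b) = (±1, ∓2)`, `|ab(a+b)| = 2`). [folklore] -/
theorem two_mul_add_ne_zero_of_natAbs_ne_two {a b : ℤ} (hab : IsCoprime a b)
    (hc : (a * b * (a + b)).natAbs ≠ 2) : 2 * a + b ≠ 0 := by
  intro h
  have hb : b = -2 * a := by linear_combination h
  subst hb
  rcases Int.isUnit_iff.mp (hab.isUnit_of_dvd' dvd_rfl ⟨-2, by ring⟩) with rfl | rfl <;>
    exact hc (by decide)

/-- **Off the CM corner, `b − a ≠ 0` for coprime `a, b`** (`a = b` forces `a = ±1`,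
`(a, b) = (±1, ±1)`). [folklore] -/
theorem sub_ne_zero_of_natAbs_ne_two {a b : ℤ} (hab : IsCoprime a b)
    (hc : (a * b * (a + b)).natAbs ≠ 2) : b - a ≠ 0 := by
  intro h
  have hb : b = a := by linear_combination h
  subst hb
  rcases Int.isUnit_iff.mp (hab.isUnit_of_dvd' dvd_rfl dvd_rfl) with rfl | rfl <;>
    exact hc (by decide)

/-- **H7 — Saito's `p = 2` leaf for EVERY Frey curve off the CM corner** (`a ⊥ b`, `ab(a+b) ≠ 0`,
`|ab(a+b)| ≠ 2`), every `ℓ`.  Presentations: `b` even → H6 verbatim (`2a + b ≠ 0` off-corner);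
`a` even → `freyCurve a b = freyCurve (−b) (−a)` (`freyCurve_swap`), H6; `a, b` odd →
`translate_freyCurve a b : E_(a,b) ≅ E_(−a,a+b)` + H7a + H6 (`2(−a) + (a+b) = b − a ≠ 0`
off-corner).  The six corner pairs `(±1,±1), (±1,∓2), (±2,∓1)` (`E ≅ 32a2`, `j = 1728`, `c₆ = 0`)
are exactly where no `2`-adic class theorem of the tree applies; they are bypassed in
`threeImpTwo_freyCurve` by the landed corner modularity.
[cite: SilvermanATAEC1994, Thm. IV.11.1 (PDF p. 365; p. 366 for p = 2)] [cite: Saito1988, Theorem 1]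
[cite: DiamondKramer1995, Lemmas 1–2] -/
theorem freySaito (hOdd : FreySwanThreeOfTwoMul) (a b : ℤ) (ℓ : ℕ) [Fact ℓ.Prime]
    (hab : IsCoprime a b) (h0 : a * b * (a + b) ≠ 0) (hc : (a * b * (a + b)).natAbs ≠ 2) :
    (freyCurve a b).swanConductorAt_rationalTate_eq_wildConductorExponent_of_ringChar_eq_two ℓ := by
  -- NB (elaboration): no `haveI`/`by_cases` here and explicit hypotheses last (see H6).
  rcases em ((2 : ℤ) ∣ b) with hb | hb
  · -- `b` even, `a` odd
    have ha : ¬ (2 : ℤ) ∣ a := fun ha ↦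
      Int.prime_two.not_unit (hab.isUnit_of_dvd' ha hb)
    -- (fully explicit `@`: a bare `exact freySaito_of_even …` makes the app elaborator unfold the
    -- instance-headed Saito def and ask for `(freyCurve a b).IsElliptic`)
    exact @freySaito_of_even a b hOdd ℓ _ h0 ha hb (two_mul_add_ne_zero_of_natAbs_ne_two hab hc)
  rcases em ((2 : ℤ) ∣ a) with ha | ha
  · -- `a` even, `b` odd: the presentation `E_(−b,−a)`
    have hc' : (b * a * (b + a)).natAbs ≠ 2 := by
      rwa [show b * a * (b + a) = a * b * (a + b) by ring]
    have hne := two_mul_add_ne_zero_of_natAbs_ne_two hab.symm hc'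
    have h0' : (-b) * (-a) * (-b + -a) ≠ 0 := by intro h; apply h0; linear_combination -h
    have hb' : ¬ (2 : ℤ) ∣ -b := fun h ↦ hb (dvd_neg.mp h)
    have ha' : (2 : ℤ) ∣ -a := dvd_neg.mpr ha
    have hne' : 2 * (-b) + (-a) ≠ 0 := by intro h; apply hne; linear_combination -h
    rw [show freyCurve a b = freyCurve (-b) (-a) from freyCurve_swap b a]
    exact @freySaito_of_even (-b) (-a) hOdd ℓ _ h0' hb' ha' hne'
  · -- `a`, `b` odd: the presentation `E_(−a,a+b)` by translation
    have hne := sub_ne_zero_of_natAbs_ne_two hab hc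
    have h0' : (-a) * (a + b) * (-a + (a + b)) ≠ 0 := by intro h; apply h0; linear_combination -h
    have ha' : ¬ (2 : ℤ) ∣ -a := fun h ↦ ha (dvd_neg.mp h)
    have hab' : (2 : ℤ) ∣ a + b := by
      have hao : Odd a := Int.not_even_iff_odd.mp (fun h ↦ ha (even_iff_two_dvd.mp h))
      have hbo : Odd b := Int.not_even_iff_odd.mp (fun h ↦ hb (even_iff_two_dvd.mp h))
      exact even_iff_two_dvd.mp (hao.add_odd hbo)
    have hne' : 2 * (-a) + (a + b) ≠ 0 := by intro h; apply hne; linear_combination h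
    exact @saitoTwo_of_smul_eq (freyCurve a b) (freyCurve (-a) (a + b)) (isElliptic_freyCurve h0) _
      (translate_freyCurve a b) ℓ _ (freySaito_of_even hOdd ℓ h0' ha' hab' hne')

/-- H7 in the shape `IsNewformOf.level_eq_conductorNorm_of_carayol1986_of_saito` consumes
(`hS : ∀ ℓ [Fact ℓ.Prime], W.⟨Saito leaf⟩ ℓ`). [cite: Saito1988, Theorem 1] -/
theorem freySaito_forall (hOdd : FreySwanThreeOfTwoMul) (a b : ℤ) (hab : IsCoprime a b)
    (h0 : a * b * (a + b) ≠ 0) (hc : (a * b * (a + b)).natAbs ≠ 2) :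
    ∀ (ℓ : ℕ) [Fact ℓ.Prime],
      (freyCurve a b).swanConductorAt_rationalTate_eq_wildConductorExponent_of_ringChar_eq_two ℓ := by
  intro ℓ _
  exact freySaito hOdd a b ℓ hab h0 hc

/-! ## Per-instance S9 for I1/I3: every Frey curve, modulo Carayol 1986 and a newform source -/

/-- **Per-instance S9 for I1/I3 — every Frey curve, modulo the Carayol-1986 Galois-form fact and a
"some-level newform" source, WITHOUT Saito's theorem.**  For coprime `a, b` with `ab(a+b) ≠ 0` and
any `ℓ`: `IsModularGaloisRepTate ℓ → BCDT.IsModular` for `E_(a,b)`.  On the CM corner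
`|ab(a+b)| = 2` the conclusion is the landed `isModular_freyCurve_of_natAbs_eq_two` (no hypothesis
used); off the corner, whatever produces a newform `f` of SOME level with `IsNewformOf (freyCurve a b) f`
from `IsModularGaloisRepTate ℓ` (`hSome`: k1's PROVED
`exists_isNewformOf_of_isModularGaloisRepTate_of_deligne_of_carayolEuler hD hCE`, or
`eichlerShimuraConstruction` + Faltings) lands at level `N_E` by
`IsNewformOf.level_eq_conductorNorm_of_carayol1986_of_saito` fed with H7.  Closing set:
{`Carayol1986_artinConductorExponent`, `hSome`} (+ `hOdd`, a landed tree theorem) — Saito's `∀ W`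
leaf is NOT in it.
[cite: BCDTJAMS2001, Introduction ((3) ⇒ (2))] [cite: CarayolASENS1986, Thm. (A)] -/
theorem threeImpTwo_freyCurve (hCA : Carayol1986_artinConductorExponent)
    (hSome : ∀ (W : WeierstrassCurve ℚ) [W.IsElliptic] (ℓ : ℕ) [Fact ℓ.Prime],
      W.IsModularGaloisRepTate ℓ →
        ∃ (N : ℕ) (_ : NeZero N) (f : CuspForm (CongruenceSubgroup.Gamma0 N) 2), IsNewformOf W f)
    (hOdd : FreySwanThreeOfTwoMul) (a b : ℤ) (hab : IsCoprime a b) (h0 : a * b * (a + b) ≠ 0)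
    [NeZero ((freyCurve a b).conductorNorm ℤ)] (ℓ : ℕ) [Fact ℓ.Prime]
    (h : (freyCurve a b).IsModularGaloisRepTate ℓ) : BCDT.IsModular (freyCurve a b) := by
  by_cases hc : (a * b * (a + b)).natAbs = 2
  · exact Summit.ABC.ABC.Theorems.isModular_freyCurve_of_natAbs_eq_two hc
  · haveI := isElliptic_freyCurve h0
    obtain ⟨N, hN, f, hf⟩ := hSome (freyCurve a b) ℓ h
    have hNE : N = (freyCurve a b).conductorNorm ℤ :=
      hf.level_eq_conductorNorm_of_carayol1986_of_saito hCA (freySaito_forall hOdd a b hab h0 hc)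
    subst hNE
    exact ⟨f, hf⟩

/-- **The I1/I3 instances in the shape the composition consumes** (`W := freyCurve a b`, any `ℓ`,
in particular `ℓ = 3` at I1 and `ℓ = 5` at I3): a drop-in for `stub_threeImpTwo (freyCurve a b) ℓ`
inside `liftThree_of_stubs` / `liftFive_of_stubs` once the lead specialises those two adapters to the
Frey curve (I2, the switched curve `W′`, is k2's recut `isModular_torsionGaloisRep_of_isNewformOf`,
which never applies S9 to `W′`). [cite: BCDTJAMS2001, Introduction ((3) ⇒ (2))] -/
theorem threeImpTwo_freyCurve' (hCA : Carayol1986_artinConductorExponent)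
    (hSome : ∀ (W : WeierstrassCurve ℚ) [W.IsElliptic] (ℓ : ℕ) [Fact ℓ.Prime],
      W.IsModularGaloisRepTate ℓ →
        ∃ (N : ℕ) (_ : NeZero N) (f : CuspForm (CongruenceSubgroup.Gamma0 N) 2), IsNewformOf W f)
    (hOdd : FreySwanThreeOfTwoMul) :
    ∀ (a b : ℤ), IsCoprime a b → a * b * (a + b) ≠ 0 →
      ∀ [NeZero ((freyCurve a b).conductorNorm ℤ)] (ℓ : ℕ) [Fact ℓ.Prime],
        (freyCurve a b).IsModularGaloisRepTate ℓ → BCDT.IsModular (freyCurve a b) :=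
  fun a b hab h0 _ ℓ _ h ↦ threeImpTwo_freyCurve hCA hSome hOdd a b hab h0 ℓ h

end Summit.ABC.ABC.Cruxes.FreyModularity.Sketch.ThreeImpTwoIdeas3g3

end
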